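import Summits.CriticalPhenomena.PercolationContinuityZ3.Theorems.PercNearOneGluingNoHeavyLowerTailStaircaseKleitman

/-!
# Nine-type oriented-antipodal programme for `Q44b`: the anchor lemma (types 1,2,3,4,6,8,9)

Support file for crux `stmt-CriticalPhenomena-4575` (master-family programme, quadratic four-point row `Q44b`),
seat `prim-bnk-1` gen 17; memo `run/shared/lean/prim/prim-l12/FROM-prim-bnk-1-gen17-NINE-TYPE-ANCHOR.md`.

**Setting (abstract typed configurations, `prim-l12-p6` gen 9 §3, `prim-bnk-1` gen 16 §10).**  In an oriented
instance `σ ≤ τ : B_m → Π₄` of the two-map antipodal statement OTA (which contains `Q44b` for every finite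
weighted graph), every *bad* point `t` has one of nine types `θ ∈ {1,…,9}` (heavy cell `τ(t)`, light cell
`σ(tᶜ)`), the *good* points form an up-set `𝔊`, and the cell algebra forces: `t ∪ t'ᶜ ∈ 𝔊` whenever
`hlOK (θ t) (θ t')` (rows `1–4 → {1..7}`, `5,6,7 → {3..7}`, `8,9 → {1,2,3,4,6,8,9}`), and `s ⊆ t` for bad
`s, t` only if `(θ s, θ t) ∈ contPairs` (equal types, or `(3,1), (4,2), (6,5), (7,5)`).  OTA is the count
`#bad ≤ #𝔊`; the route to it (gen 16 §8–§10) is the GF(2) rank of inclusion matrices `[ρ(t) ⊆ g]`.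

**Theorem (`NineType.anchor_exists_odd_target`, the anchor lemma).**  If all points of `𝒯` have types in
`{1,2,3,4,6,8,9}` then for every nonempty `𝒮 ⊆ 𝒯` some `g ∈ 𝔊` contains an odd number of members of `𝒮`;
i.e. the rows `[t ⊆ g]` (`t ∈ 𝒯`, `g ∈ 𝔊`) are linearly independent over GF(2).  Consequently
(`NineType.anchor_card_le`) `#𝒯 ≤ #𝔊`.  Only the two types `5, 7` (heavy `ab|c|y`, light `a|b|cy` resp.
`a|bcy`) are left out; by the two-copy fibre expansion this is the packing inequality
`P(ab|cy)[P(ac|by)+P(ay|bc)] + P(ab|c|y)[P(ac|by)+P(ay|bc)+P(acy|b)] + P(a|bcy)[P(ac|b|y)+P(ay|b|c)] ≤ P(AC)·P(∅)`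
for all finite weighted graphs (paper level; the law-level bridge is not in this file).

**Proof.**  Odd-trace (`StaircaseKleitman.exists_odd_trace`) at a `⊆`-maximal member `M`: the odd target
`T* = Mᶜ ∪ R ∉ 𝔊` contains `S₀ ∪ Mᶜ` for some member `S₀`, so `hlOK (θ S₀) (θ M) = false`; the table forces
`θ M ∈ {1,2,8,9}`, with `θ S₀ = 6` if `θ M ∈ {1,2}`.  A minimal member below a maximal one has, by `contPairs`,
type in `{1,2,3,4,8,9}` (and type `θ M` if `θ M ∈ {8,9}`); every member lies above a minimal one, so no member
has type `6`; hence every maximal member has type `8` or `9`, hence every member has type `8` or `9`, and then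
no witness `S₀` (type `≤ 7`) exists — contradiction.

Pure finite combinatorics; no named facts, no sorries, standard axioms.
-/

namespace Summit.CriticalPhenomena.PercolationContinuityZ3.Theorems

namespace NineType

open Finset

/-- HL-compatibility table of the nine `Q44b` bad types (`prim-l12-p6` gen 9 §2, table HL): `hlOK a b` iff
the heavy cell of type `a` joined with the light cell of type `b` lies in `AC = {abcy, ab|cy}` and the light cell
of `a` meets the heavy cell of `b` in `⊥`; then `t ∪ t'ᶜ` is a good point for bad `t, t'` of types `a, b`.
Rows: `1–4 → {1,…,7}`, `5,6,7 → {3,…,7}`, `8,9 → {1,2,3,4,6,8,9}`. -/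
def hlOK (a b : ℕ) : Bool :=
  ((a == 1 || a == 2 || a == 3 || a == 4) && (b == 1 || b == 2 || b == 3 || b == 4 || b == 5 || b == 6 || b == 7))
  || ((a == 5 || a == 6 || a == 7) && (b == 3 || b == 4 || b == 5 || b == 6 || b == 7))
  || ((a == 8 || a == 9) && (b == 1 || b == 2 || b == 3 || b == 4 || b == 6 || b == 8 || b == 9))

/-- Containment table (`prim-l12-p6` gen 9 §3, CONT): a bad point of type `a` can be contained in a bad point of
type `b` only if `(a, b) ∈ contPairs` — equal types, or `(3,1), (4,2), (6,5), (7,5)`. -/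
def contPairs : Finset (ℕ × ℕ) :=
  {(1, 1), (2, 2), (3, 3), (4, 4), (5, 5), (6, 6), (7, 7), (8, 8), (9, 9), (3, 1), (4, 2), (6, 5), (7, 5)}

/-- The anchored types: all nine types except `5` and `7`. -/
def anchorTypes : Finset ℕ := {1, 2, 3, 4, 6, 8, 9}

/-- Table fact (a): for an HL-incompatible pair `(x, M)` of anchored types, `M ∈ {1,2,8,9}`; if `M ∈ {1,2}`
then `x = 6`, and if `M ∈ {8,9}` then `x ∉ {8,9}`. -/
theorem table_incompatible : ∀ x ∈ anchorTypes, ∀ M ∈ anchorTypes, hlOK x M = false →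
    (M = 1 ∨ M = 2 ∨ M = 8 ∨ M = 9) ∧ ((M = 1 ∨ M = 2) → x = 6) ∧ ((M = 8 ∨ M = 9) → x ≠ 8 ∧ x ≠ 9) := by
  intro x hx M hM
  simp only [anchorTypes, Finset.mem_insert, Finset.mem_singleton] at hx hM
  rcases hx with rfl | rfl | rfl | rfl | rfl | rfl | rfl <;>
    rcases hM with rfl | rfl | rfl | rfl | rfl | rfl | rfl <;> decide

/-- Table fact (b): the anchored types that may lie below a type in `{1,2,8,9}`. -/
theorem table_below_max : ∀ m ∈ anchorTypes, ∀ M ∈ anchorTypes, (M = 1 ∨ M = 2 ∨ M = 8 ∨ M = 9) →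
    (m, M) ∈ contPairs → (m = 1 ∨ m = 2 ∨ m = 3 ∨ m = 4 ∨ m = 8 ∨ m = 9) ∧ ((M = 8 ∨ M = 9) → m = M) := by
  intro m hm M hM hM' h
  simp only [anchorTypes, Finset.mem_insert, Finset.mem_singleton] at hm hM
  rcases hm with rfl | rfl | rfl | rfl | rfl | rfl | rfl <;>
    rcases hM with rfl | rfl | rfl | rfl | rfl | rfl | rfl <;>
    simp_all [contPairs]

/-- Table fact (c): the anchored types that may lie above a type in `{1,2,3,4,8,9}`: never `6`, and equal to the
lower type if that is `8` or `9`. -/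
theorem table_above_min : ∀ m ∈ anchorTypes, ∀ S ∈ anchorTypes, (m = 1 ∨ m = 2 ∨ m = 3 ∨ m = 4 ∨ m = 8 ∨ m = 9) →
    (m, S) ∈ contPairs → S ≠ 6 ∧ ((m = 8 ∨ m = 9) → S = m) := by
  intro m hm S hS hm' h
  simp only [anchorTypes, Finset.mem_insert, Finset.mem_singleton] at hm hS
  rcases hm with rfl | rfl | rfl | rfl | rfl | rfl | rfl <;>
    rcases hS with rfl | rfl | rfl | rfl | rfl | rfl | rfl <;>
    simp_all [contPairs]

variable {α : Type*} [DecidableEq α]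

/-- Parity-signature injectivity: if every nonempty subfamily of `E` has an odd target in `Z`, then
`𝒮 ↦ {T ∈ Z : #{S ∈ 𝒮 : S ⊆ T} odd}` is injective on the subfamilies of `E`, hence `#E ≤ #Z`
(the GF(2)-rank argument of gen 16 §8, in counting form). -/
theorem card_le_card_of_odd_targets (E Z : Finset (Finset α))
    (hodd : ∀ 𝒮 ⊆ E, 𝒮.Nonempty → ∃ T ∈ Z, Odd #(𝒮.filter (fun S => S ⊆ T))) : #E ≤ #Z := by
  have hinj : Set.InjOn (fun 𝒮 : Finset (Finset α) =>
      Z.filter (fun T => Odd #(𝒮.filter (fun S => S ⊆ T)))) (E.powerset : Set (Finset (Finset α))) := by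
    intro 𝒮₁ h₁ 𝒮₂ h₂ heq
    have h₁' : 𝒮₁ ⊆ E := Finset.mem_powerset.1 (Finset.mem_coe.1 h₁)
    have h₂' : 𝒮₂ ⊆ E := Finset.mem_powerset.1 (Finset.mem_coe.1 h₂)
    by_contra hne
    set 𝒟 : Finset (Finset α) := (𝒮₁ \ 𝒮₂) ∪ (𝒮₂ \ 𝒮₁) with h𝒟
    have h𝒟E : 𝒟 ⊆ E := by
      intro S hS
      rcases Finset.mem_union.1 hS with h | h
      · exact h₁' (Finset.mem_sdiff.1 h).1
      · exact h₂' (Finset.mem_sdiff.1 h).1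
    have h𝒟ne : 𝒟.Nonempty := by
      rw [Finset.nonempty_iff_ne_empty]
      intro hemp
      apply hne
      have h12 : 𝒮₁ \ 𝒮₂ = ∅ :=
        Finset.subset_empty.1 (by rw [← hemp]; exact Finset.subset_union_left)
      have h21 : 𝒮₂ \ 𝒮₁ = ∅ :=
        Finset.subset_empty.1 (by rw [← hemp]; exact Finset.subset_union_right)
      exact Finset.Subset.antisymm (Finset.sdiff_eq_empty_iff_subset.1 h12)
        (Finset.sdiff_eq_empty_iff_subset.1 h21)
    obtain ⟨T, hTZ, hoddT⟩ := hodd 𝒟 h𝒟E h𝒟ne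
    have hsame : Odd #(𝒮₁.filter (fun S => S ⊆ T)) ↔ Odd #(𝒮₂.filter (fun S => S ⊆ T)) := by
      have hT := congrArg (fun F => T ∈ F) heq
      simp only [Finset.mem_filter, eq_iff_iff] at hT
      constructor
      · intro h; exact (hT.1 ⟨hTZ, h⟩).2
      · intro h; exact (hT.2 ⟨hTZ, h⟩).2
    set a := #((𝒮₁ \ 𝒮₂).filter (fun S => S ⊆ T)) with ha
    set b := #((𝒮₂ \ 𝒮₁).filter (fun S => S ⊆ T)) with hb
    set c := #((𝒮₁ ∩ 𝒮₂).filter (fun S => S ⊆ T)) with hc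
    have hdisj : Disjoint (𝒮₁ \ 𝒮₂) (𝒮₂ \ 𝒮₁) := by
      rw [Finset.disjoint_left]
      intro S hS hS'
      exact (Finset.mem_sdiff.1 hS).2 (Finset.mem_sdiff.1 hS').1
    have hcard𝒟 : #(𝒟.filter (fun S => S ⊆ T)) = a + b := by
      rw [h𝒟, Finset.filter_union]
      exact Finset.card_union_of_disjoint (Finset.disjoint_filter_filter hdisj)
    have hsplit₁ : #(𝒮₁.filter (fun S => S ⊆ T)) = a + c := by
      rw [ha, hc, ← Finset.card_union_of_disjoint
        (Finset.disjoint_filter_filter (Finset.disjoint_sdiff_inter 𝒮₁ 𝒮₂)),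
        ← Finset.filter_union, Finset.sdiff_union_inter]
    have hsplit₂ : #(𝒮₂.filter (fun S => S ⊆ T)) = b + c := by
      rw [hb, hc, Finset.inter_comm, ← Finset.card_union_of_disjoint
        (Finset.disjoint_filter_filter (Finset.disjoint_sdiff_inter 𝒮₂ 𝒮₁)),
        ← Finset.filter_union, Finset.sdiff_union_inter]
    have hiff : Even (a + c) ↔ Even (b + c) := by
      rw [← hsplit₁, ← hsplit₂, ← Nat.not_odd_iff_even, ← Nat.not_odd_iff_even]
      exact not_congr hsame
    have h2 : Even ((a + c) + (b + c)) := Nat.even_add.2 hiff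
    have h3 : (a + c) + (b + c) = (a + b) + 2 * c := by ring
    rw [h3, Nat.even_add] at h2
    have heven : Even (a + b) := h2.2 (even_two_mul c)
    rw [← hcard𝒟] at heven
    exact (Nat.not_even_iff_odd.2 hoddT) heven
  have hmaps : Set.MapsTo (fun 𝒮 : Finset (Finset α) =>
        Z.filter (fun T => Odd #(𝒮.filter (fun S => S ⊆ T))))
      (E.powerset : Set (Finset (Finset α))) (Z.powerset : Set (Finset (Finset α))) := by
    intro 𝒮 _
    exact Finset.mem_coe.2 (Finset.mem_powerset.2 (Finset.filter_subset _ _))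
  have hle : #(E.powerset) ≤ #(Z.powerset) := Finset.card_le_card_of_injOn _ hmaps hinj
  rw [Finset.card_powerset, Finset.card_powerset] at hle
  exact (Nat.pow_le_pow_iff_right (by norm_num : 1 < 2)).1 hle

variable [Fintype α]

/-- **Anchor lemma (odd-target form).**  Let `𝒯` be a family of bad points with anchored types
(`θ t ∈ anchorTypes = {1,2,3,4,6,8,9}`), `contPairs`-compatible along containments, and let the up-set `𝔊` contain `t ∪ t'ᶜ`
for every HL-compatible pair.  Then every nonempty `𝒮 ⊆ 𝒯` has a target `g ∈ 𝔊` containing an odd number of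
its members (the inclusion rows `[t ⊆ g]`, `t ∈ 𝒯`, are linearly independent over GF(2)).  [this work] -/
theorem anchor_exists_odd_target (𝒯 : Finset (Finset α)) (θ : Finset α → ℕ)
    (hθ : ∀ t ∈ 𝒯, θ t ∈ anchorTypes)
    (hcont : ∀ s ∈ 𝒯, ∀ t ∈ 𝒯, s ⊆ t → (θ s, θ t) ∈ contPairs)
    (𝔊 : Finset (Finset α)) (hG : IsUpperSet (𝔊 : Set (Finset α)))
    (hHL : ∀ t ∈ 𝒯, ∀ t' ∈ 𝒯, hlOK (θ t) (θ t') = true → t ∪ t'ᶜ ∈ 𝔊)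
    (𝒮 : Finset (Finset α)) (hS𝒯 : 𝒮 ⊆ 𝒯) (hne : 𝒮.Nonempty) :
    ∃ g ∈ 𝔊, Odd #(𝒮.filter (fun S => S ⊆ g)) := by
  by_contra hcon
  simp only [not_exists, not_and] at hcon
  have upG : ∀ {S T : Finset α}, S ∈ 𝔊 → S ⊆ T → T ∈ 𝔊 := fun {S T} hS hST => hG hST hS
  -- Step (a): at a maximal member `M` there is a witness `S₀ ∈ 𝒮` with `hlOK (θ S₀) (θ M) = false`.
  have stepA : ∀ M ∈ 𝒮, (∀ S ∈ 𝒮, M ⊆ S → S = M) → ∃ S₀ ∈ 𝒮, hlOK (θ S₀) (θ M) = false := by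
    intro M hM hmax
    obtain ⟨R, _, hodd⟩ := StaircaseKleitman.exists_odd_trace 𝒮 M hM hmax
    set T : Finset α := Mᶜ ∪ R with hT
    have hfilt : 𝒮.filter (fun S => S ⊆ T) = 𝒮.filter (fun S => S ∩ M ⊆ R) := by
      refine Finset.filter_congr ?_
      intro S _
      exact StaircaseKleitman.subset_compl_union_iff S M R
    have hoddT : Odd #(𝒮.filter (fun S => S ⊆ T)) := by rw [hfilt]; exact hodd
    have hpos : 0 < #(𝒮.filter (fun S => S ⊆ T)) := Nat.pos_of_ne_zero (fun h0 => by
      rw [h0] at hoddT; exact (Nat.not_odd_iff_even.2 (by decide)) hoddT)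
    obtain ⟨S₀, hS₀⟩ := Finset.card_pos.1 hpos
    have hS₀𝒮 : S₀ ∈ 𝒮 := (Finset.mem_filter.1 hS₀).1
    have hS₀T : S₀ ⊆ T := (Finset.mem_filter.1 hS₀).2
    refine ⟨S₀, hS₀𝒮, ?_⟩
    cases hok : hlOK (θ S₀) (θ M) with
    | false => rfl
    | true =>
      exfalso
      have hgood : S₀ ∪ Mᶜ ∈ 𝔊 := hHL S₀ (hS𝒯 hS₀𝒮) M (hS𝒯 hM) hok
      have hsub : S₀ ∪ Mᶜ ⊆ T := Finset.union_subset hS₀T Finset.subset_union_left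
      exact hcon T (upG hgood hsub) hoddT
  -- maximal and minimal members exist above / below any member
  have exists_max_above : ∀ S ∈ 𝒮, ∃ M ∈ 𝒮, S ⊆ M ∧ ∀ S' ∈ 𝒮, M ⊆ S' → S' = M := by
    intro S hS
    have habove : (𝒮.filter (fun S' => S ⊆ S')).Nonempty := ⟨S, Finset.mem_filter.2 ⟨hS, subset_rfl⟩⟩
    obtain ⟨M, hM, hMmax⟩ := Finset.exists_max_image (𝒮.filter (fun S' => S ⊆ S')) card habove
    refine ⟨M, (Finset.mem_filter.1 hM).1, (Finset.mem_filter.1 hM).2, ?_⟩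
    intro S' hS' hMS'
    have hS'f : S' ∈ 𝒮.filter (fun S'' => S ⊆ S'') :=
      Finset.mem_filter.2 ⟨hS', ((Finset.mem_filter.1 hM).2).trans hMS'⟩
    exact (Finset.eq_of_subset_of_card_le hMS' (hMmax S' hS'f)).symm
  have exists_min_below : ∀ S ∈ 𝒮, ∃ m ∈ 𝒮, m ⊆ S ∧ ∀ S' ∈ 𝒮, S' ⊆ m → S' = m := by
    intro S hS
    have hbelow : (𝒮.filter (fun S' => S' ⊆ S)).Nonempty := ⟨S, Finset.mem_filter.2 ⟨hS, subset_rfl⟩⟩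
    obtain ⟨m, hm, hmmin⟩ := Finset.exists_min_image (𝒮.filter (fun S' => S' ⊆ S)) card hbelow
    refine ⟨m, (Finset.mem_filter.1 hm).1, (Finset.mem_filter.1 hm).2, ?_⟩
    intro S' hS' hS'm
    have hS'f : S' ∈ 𝒮.filter (fun S'' => S'' ⊆ S) :=
      Finset.mem_filter.2 ⟨hS', hS'm.trans (Finset.mem_filter.1 hm).2⟩
    exact Finset.eq_of_subset_of_card_le hS'm (hmmin S' hS'f)
  -- types of maximal members lie in `{1,2,8,9}`
  have maxType : ∀ M ∈ 𝒮, (∀ S ∈ 𝒮, M ⊆ S → S = M) →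
      (θ M = 1 ∨ θ M = 2 ∨ θ M = 8 ∨ θ M = 9) := by
    intro M hM hmax
    obtain ⟨S₀, hS₀, hbad⟩ := stepA M hM hmax
    exact (table_incompatible _ (hθ S₀ (hS𝒯 hS₀)) _ (hθ M (hS𝒯 hM)) hbad).1
  -- Step (b): no member has type `6`; a member below a maximal member of type `8`/`9` has the same type.
  have stepB : ∀ S ∈ 𝒮, θ S ≠ 6 := by
    intro S hS
    obtain ⟨m, hm, hmS, hmmin⟩ := exists_min_below S hS
    obtain ⟨M, hM, hmM, hMmax⟩ := exists_max_above m hm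
    have hMt := maxType M hM hMmax
    have hmt := (table_below_max _ (hθ m (hS𝒯 hm)) _ (hθ M (hS𝒯 hM)) hMt (hcont m (hS𝒯 hm) M (hS𝒯 hM) hmM)).1
    exact (table_above_min _ (hθ m (hS𝒯 hm)) _ (hθ S (hS𝒯 hS)) hmt (hcont m (hS𝒯 hm) S (hS𝒯 hS) hmS)).1
  -- hence maximal members have type `8` or `9`
  have maxType' : ∀ M ∈ 𝒮, (∀ S ∈ 𝒮, M ⊆ S → S = M) → (θ M = 8 ∨ θ M = 9) := by
    intro M hM hmax
    obtain ⟨S₀, hS₀, hbad⟩ := stepA M hM hmax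
    have htab := table_incompatible _ (hθ S₀ (hS𝒯 hS₀)) _ (hθ M (hS𝒯 hM)) hbad
    rcases htab.1 with h1 | h2 | h8 | h9
    · exact absurd (htab.2.1 (Or.inl h1)) (stepB S₀ hS₀)
    · exact absurd (htab.2.1 (Or.inr h2)) (stepB S₀ hS₀)
    · exact Or.inl h8
    · exact Or.inr h9
  -- hence every member has type `8` or `9`
  have allType : ∀ S ∈ 𝒮, θ S = 8 ∨ θ S = 9 := by
    intro S hS
    obtain ⟨m, hm, hmS, hmmin⟩ := exists_min_below S hS
    obtain ⟨M, hM, hmM, hMmax⟩ := exists_max_above m hm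
    have hM89 := maxType' M hM hMmax
    have hMt : θ M = 1 ∨ θ M = 2 ∨ θ M = 8 ∨ θ M = 9 := by
      rcases hM89 with h | h
      · exact Or.inr (Or.inr (Or.inl h))
      · exact Or.inr (Or.inr (Or.inr h))
    have hb := table_below_max _ (hθ m (hS𝒯 hm)) _ (hθ M (hS𝒯 hM)) hMt (hcont m (hS𝒯 hm) M (hS𝒯 hM) hmM)
    have hmeq : θ m = θ M := hb.2 hM89
    have hm89 : θ m = 8 ∨ θ m = 9 := by rw [hmeq]; exact hM89
    have hmt : θ m = 1 ∨ θ m = 2 ∨ θ m = 3 ∨ θ m = 4 ∨ θ m = 8 ∨ θ m = 9 := hb.1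
    have ha := table_above_min _ (hθ m (hS𝒯 hm)) _ (hθ S (hS𝒯 hS)) hmt (hcont m (hS𝒯 hm) S (hS𝒯 hS) hmS)
    rw [ha.2 hm89]
    exact hm89
  -- Step (c): contradiction at a maximal member.
  obtain ⟨S₁, hS₁⟩ := hne
  obtain ⟨M, hM, _, hMmax⟩ := exists_max_above S₁ hS₁
  obtain ⟨S₀, hS₀, hbad⟩ := stepA M hM hMmax
  have htab := table_incompatible _ (hθ S₀ (hS𝒯 hS₀)) _ (hθ M (hS𝒯 hM)) hbad
  have hne89 := htab.2.2 (maxType' M hM hMmax)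
  rcases allType S₀ hS₀ with h8 | h9
  · exact hne89.1 h8
  · exact hne89.2 h9

/-- **Anchor lemma (counting form).**  Under the hypotheses of `anchor_exists_odd_target`, the bad points of
anchored types are at most as numerous as the good points: `#𝒯 ≤ #𝔊`.  [this work] -/
theorem anchor_card_le (𝒯 : Finset (Finset α)) (θ : Finset α → ℕ)
    (hθ : ∀ t ∈ 𝒯, θ t ∈ anchorTypes)
    (hcont : ∀ s ∈ 𝒯, ∀ t ∈ 𝒯, s ⊆ t → (θ s, θ t) ∈ contPairs)
    (𝔊 : Finset (Finset α)) (hG : IsUpperSet (𝔊 : Set (Finset α)))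
    (hHL : ∀ t ∈ 𝒯, ∀ t' ∈ 𝒯, hlOK (θ t) (θ t') = true → t ∪ t'ᶜ ∈ 𝔊) : #𝒯 ≤ #𝔊 :=
  card_le_card_of_odd_targets 𝒯 𝔊 (fun 𝒮 hS hne =>
    anchor_exists_odd_target 𝒯 θ hθ hcont 𝔊 hG hHL 𝒮 hS hne)

end NineType

end Summit.CriticalPhenomena.PercolationContinuityZ3.Theorems
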